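import Literature.NumberTheory.LFunctions.HeckeLOneLowerBoundExplicit
import HarnessLib

/-!
# The two-world dictionary of a moment-method family design at the ½-edge: a K-crux «generic
# asymptotics uniformly on a covering window», once its deviation is FORCED to main order by a
# close real zero, already contains a zero-free region — and then (Hecke) the payoff
# `L(1,χ_D) ≫ 1/log D` itself (INTERFACE/schema file of the §E barrier row famE-07)

Topic `Literature/NumberTheory/LFunctions` (namespace `Literature.NumberTheory.LFunctions.TwoWorld`).
Cell `landau-siegel` (LANDAU–SIEGEL PROGRAMME, rung F-S3), §D-fam ⇒ §E barrier row **famE-07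
«GL(1)-completeness of moment-method family routes at the ½-edge»** (BARRIER-STATE §2′ N16,
ls-barrier-plan g1 02:54:15Z). This file is the KERNEL HOME of the critic's signature draft
`HOME/ls-knife-crit-3/TwoWorldSketch.lean` (ls-knife-crit-3 g5: v1 8d5d8dd4e35872ed 02:28:54Z, v2
cdfd206c7a36ec06 02:37:22Z «adds the DECORATIVENESS TEST (Hecke)», file as read e10eae5c0dfcdf8c;
farm rc 0, 0 sorry), ADOPTED by ls-theory g2 02:52:29Z «as the TYPED FORM OF RECORD of the famE-07
mechanism … if a kernel home is wanted, the natural owner is knife-typer-3 g7 … as an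
INTERFACE/schema file with that docstring — theory co-reads», second reader ls-knife-crit-2 g4
02:43:38Z CONCURS, model-consistency gate ls-ref-1 g2 02:36:14Z. Landed by ls-knife-typer-3 g7
(§D typer, edge fam) with the critic's declarations VERBATIM (`RealZeroWithin`, `Design`,
`GenericAsymptotics`, `Covers`, `eventually_zeroFree_of_genericAsymptotics`,
`eventually_lOne_ge_of_genericAsymptotics`) plus the gate's junk inhabitant made kernel
(`junkDesign`, `genericAsymptotics_junkDesign_iff`). DEFINITIONS with bodies, one STRUCTURE whose
(A)-side mechanism is a HYPOTHESIS FIELD, and PROVED theorems; NO named fact, nothing asserted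
about any concrete design.

## THE DICTIONARY SENTENCE (ls-ref-1 g2 02:36:14Z, verbatim per ls-theory 02:52:29Z — binding on
## every reader of this file)

«`Design` is a dictionary; an instance is evidence-free (junk inhabitant
`dev := 𝟙[RealZeroWithin]`); content enters only through a certified `dev` and a `forced` DERIVED
from a two-world formula (KMV p.28 / BPZ23 §3.1 / BM15 p.13), L-priced each; no card may cite a
Design instance as progress.» — `genericAsymptotics_junkDesign_iff` below is that junk inhabitant
in kernel: for it, `GenericAsymptotics` IS literally an eventual no-real-zero statement.

## What the critic's draft says (CRIT-3-g5-dichotomy.md (D2)/(D3′); famE-07 pack da83c0ea4159b3f4)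

This is the COSTUME direction only (ls-ref-1 02:15:25Z caveat; AMENDMENT (D3′)): a moment-method
design whose deviation `dev X D` (true certified value minus generic certified value, at family
scale `X`, against the real primitive modulus `D`) is FORCED to main order by a real zero near `1`
(the β-term mechanism, here the explicit hypothesis field `Design.forced`) has a K-crux («generic
asymptotics uniformly on the window», `GenericAsymptotics`) that already contains an eventual
`σ > 1 − c/log D` zero-free statement for the moduli it serves
(`eventually_zeroFree_of_genericAsymptotics`: «K-crux ⊒ NoSiegelZeros(u₀/B)» — no converse is
claimed; equality would hold only modulo a family-dependent two-world formula). With the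
normalisation `B < 4u₀` the crux ALONE already yields `L(1,χ_D) ≥ 1/(12 log D)` on the window via
the tree's kernel Hecke lemma `Hecke.lOne_ge_of_noRealZero_near_one`
(`eventually_lOne_ge_of_genericAsymptotics`, the «decorativeness test»: for such a design the GL(2)
apparatus is decorative — the crux out-delivers the route's own payoff `LOneLowerBound A`).
Nothing here asserts that any concrete design satisfies `forced`; instantiating `forced` for the
prime-level / tower / constrained-mollifier designs is the INFORMAL half of row famE-07 — the
β-term `∝ M^{β−1}` of the (A)-world mollified moments, in print at prime level: KMV 2000 §8.4
p. 28 («this is the absolute limit of our method, barring any improvement in the (logarithmic)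
length of the mollifier Δ beyond 1 … feasible assuming GRH for Dirichlet L functions as shown by
Iwaniec and Sarnak [I-S]», read on the page by the typer of `KMVMollifiedMomentForms.lean`),
Bui–Pratt–Zaharescu 2023 §3.1 / Prop. 3.1 (the (A)-world mollified moments with the explicit factor
`1 ± ψ(q)`), Blomer–Milićević 2015 p. 13 (Siegel's bound in a nebentypus Kuznetsov computation).

WHAT THIS IS NOT: not a barrier record (the famE-07 ROW is ls-barrier-plan's, BARRIER-STATE §2′
N16); not a claim that any §D-fam card's design is `forced`; no converse «NoSiegelZeros ⇒ K-crux»;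
no claim about the ½-proportion edge. «The programme SEARCHES and TYPES; no claim about
Landau–Siegel zeros, Theorems 1–2 of arXiv:2211.02515 or a repaired Margin232 until a kernel
theorem says so.»

## References

* [KowalskiMichelVanderKam2000] E. Kowalski, P. Michel, J. VanderKam, J. reine angew. Math. 526
  (2000), §8.4 p. 28 L73–77 (the GRH/[I-S] remark on `Δ > 1`) — held
  `paper:doi-10-1515-crll-2000-074`.
* [BuiPrattZaharescu2023] H. M. Bui, K. Pratt, A. Zaharescu, *Analytic ranks of automorphic
  L-functions and Landau–Siegel zeros*, JLMS 2023, §3.1 «The mollifier» [corpus: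
  paper:doi-10-1112-jlms-12834 p6 L33], Prop. 3.1 [p7 L49–L55].
* [MontgomeryVaughan2007] H. L. Montgomery, R. C. Vaughan, *Multiplicative Number Theory I*,
  Theorem 11.4 (11.7)/(11.10) p. 277, §11.2 Exercise 6(b) p. 287 — the tree's
  `Literature.NumberTheory.LFunctions.Hecke.lOne_ge_of_noRealZero_near_one`
  (`HeckeLOneLowerBoundExplicit.lean`).
* Cell files: CRIT-3-g5-dichotomy.md 57a723064bc56a27; CRIT-3-famE07-pack.md da83c0ea4159b3f4;
  BARRIER-STATE §2′ N16 (ls-barrier-plan g1 02:54:15Z).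
-/

noncomputable section

namespace Literature.NumberTheory.LFunctions.TwoWorld

/-- «`D` has an exceptional real zero at scale `u/log X`»: some real (quadratic) primitive
character mod `D` has a real zero of its L-function in `(1 − u/log X, 1)`.
[cite: MontgomeryVaughan2007, §11.2 (exceptional real zero `β₁ > 1 − c/log q`)] -/
def RealZeroWithin (u : ℝ) (X D : ℕ) [NeZero D] : Prop :=
  ∃ χ : DirichletCharacter ℂ D, χ.IsQuadratic ∧ χ.IsPrimitive ∧
    ∃ σ : ℝ, 1 - u / Real.log X < σ ∧ σ < 1 ∧ χ.LFunction σ = 0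

/-- **The abstract two-world datum of a moment-method family design** (a DICTIONARY — see the
file docstring: an instance is evidence-free, `junkDesign`): a window of moduli `D` served at each
family scale `X`, a deviation functional `dev X D` (true-minus-generic certified quantity), and
the (A)-side β-term mechanism as a HYPOTHESIS FIELD `forced`: a real zero within `u₀/log X` of
`1` for a served modulus forces `|dev X D| ≥ θ > 0`. [cite: KowalskiMichelVanderKam2000, §8.4
p. 28 (the (A)/GRH-dependence of mollified moments beyond `Δ = 1`, [I-S])] -/
structure Design where
  /-- moduli `D` served at family scale `X` (e.g. `D ≤ X^δ`, or `X^{δ/2} ≤ D ≤ X^δ`) -/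
  window : ℕ → Set ℕ
  /-- true-minus-generic deviation of the certified quantity at scale `X` against modulus `D` -/
  dev : ℕ → ℕ → ℝ
  /-- the zero-proximity scale `u₀` of the mechanism -/
  u₀ : ℝ
  /-- the main-order size `θ` the deviation is forced to -/
  θ : ℝ
  /-- `θ > 0` -/
  hθ : 0 < θ
  /-- the β-term mechanism (INFORMAL half of famE-07), POSITED as a field: -/
  forced : ∀ (X D : ℕ) [NeZero D], D ∈ window X → RealZeroWithin u₀ X D → θ ≤ |dev X D|

/-- **The K-crux shape of every §D-fam card so far**: the generic (β-free) asymptotics hold with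
`o(1)` error UNIFORMLY over the window — `∀ ε > 0, ∃ X₀, ∀ X ≥ X₀, ∀ D ∈ window X, |dev X D| < ε`.
[cite: KowalskiMichelVanderKam2000, §8.4 p. 28 («improvement in the (logarithmic) length of the
mollifier Δ beyond 1 … feasible assuming GRH»)] -/
def GenericAsymptotics (d : Design) : Prop :=
  ∀ ε : ℝ, 0 < ε → ∃ X₀ : ℕ, ∀ X : ℕ, X₀ ≤ X → ∀ (D : ℕ) [NeZero D], D ∈ d.window X →
    |d.dev X D| < ε

/-- **The window COVERS the large moduli at logarithmic cost `B`**: every large `D` is served by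
arbitrarily large scales `X` with `0 < log X ≤ B · log D` (e.g. `D ≍ X^δ` gives `B = 1/δ`).
[cite: KowalskiMichelVanderKam2000, §8.4 p. 28 (uniformity in the level)] -/
def Covers (d : Design) (B : ℝ) : Prop :=
  ∀ X₀ : ℕ, ∃ D₀ : ℕ, ∀ D : ℕ, D₀ ≤ D → ∃ X : ℕ, X₀ ≤ X ∧ D ∈ d.window X ∧
    0 < Real.log X ∧ Real.log X ≤ B * Real.log D

/-- **(D3′), typed — the costume direction.** For a design whose deviation is forced to main order
by a close real zero, the K-crux «generic asymptotics uniformly on a covering window» contains the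
eventual zero-free region `σ > 1 − (u₀/B)/log D` for real primitive characters — i.e. it is at
least as strong as (the large-`D` part of) `NoSiegelZeros` with constant `u₀/B`. (Critic's draft,
verbatim.) [cite: KowalskiMichelVanderKam2000, §8.4 p. 28 ([I-S]: `Δ > 1` from GRH for Dirichlet
L-functions — the print locus of «the crux lives above a zero-free statement»)] -/
theorem eventually_zeroFree_of_genericAsymptotics (d : Design) {B : ℝ} (hB : 0 < B)
    (hu : 0 < d.u₀) (hgen : GenericAsymptotics d) (hcov : Covers d B) :
    ∃ D₀ : ℕ, ∀ (D : ℕ) [NeZero D], D₀ ≤ D →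
      ∀ χ : DirichletCharacter ℂ D, χ.IsQuadratic → χ.IsPrimitive →
        ∀ σ : ℝ, 1 - (d.u₀ / B) / Real.log D < σ → σ < 1 → χ.LFunction σ ≠ 0 := by
  obtain ⟨X₀, hX₀⟩ := hgen d.θ d.hθ
  obtain ⟨D₀, hD₀⟩ := hcov X₀
  refine ⟨D₀, fun D _ hD χ hq hp σ hσ hσ1 hL => ?_⟩
  obtain ⟨X, hX, hwin, hlogX, hlogXD⟩ := hD₀ D hD
  have hlt : |d.dev X D| < d.θ := hX₀ X hX D hwin
  have hlogD : 0 < Real.log D := by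
    have : 0 < B * Real.log D := lt_of_lt_of_le hlogX hlogXD
    exact (mul_pos_iff_of_pos_left hB).mp this
  -- the zero at `σ` is within `u₀/log X` of `1`, since `log X ≤ B log D`
  have hzero : RealZeroWithin d.u₀ X D := by
    refine ⟨χ, hq, hp, σ, ?_, hσ1, hL⟩
    have h1 : d.u₀ / B / Real.log D ≤ d.u₀ / Real.log X := by
      rw [div_div]
      exact div_le_div_of_nonneg_left hu.le hlogX (by nlinarith)
    linarith
  have hge : d.θ ≤ |d.dev X D| := d.forced X D hwin hzero
  exact absurd hlt (not_lt.mpr hge)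

/-- **Decorativeness test (Hecke), typed.** Under the same hypotheses, with the normalisation
`B < 4·u₀` (so the crux's zero-free region contains `[1 − 1/(4 log D), 1]`), the K-crux ALONE
already gives `L(1,χ_D) ≥ 1/(12 log D)` for every large served modulus `D ≥ 10⁴` and every real
primitive `χ_D` — by the tree's kernel Hecke lemma `Hecke.lOne_ge_of_noRealZero_near_one`, with
NO family, no moments, no purity and no pigeonhole: for such a design the GL(2) apparatus is
decorative, the crux out-delivering the route's own payoff `LOneLowerBound A` (`A ≥ 1`) on its
window. (Critic's draft v2, verbatim.) [cite: MontgomeryVaughan2007, Theorem 11.4 (11.7)/(11.10)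
p. 277 and §11.2 Exercise 6(b) p. 287 (Hecke)] -/
theorem eventually_lOne_ge_of_genericAsymptotics (d : Design) {B : ℝ} (hB : 0 < B)
    (hu : B < 4 * d.u₀) (hgen : GenericAsymptotics d) (hcov : Covers d B) :
    ∃ D₀ : ℕ, ∀ (D : ℕ) [NeZero D], D₀ ≤ D → 10 ^ 4 ≤ D →
      ∀ χ : DirichletCharacter ℂ D, χ.IsQuadratic → χ.IsPrimitive →
        1 / (12 * Real.log D) ≤ (χ.LFunction 1).re := by
  have hu0 : 0 < d.u₀ := by linarith
  obtain ⟨D₀, hD₀⟩ := eventually_zeroFree_of_genericAsymptotics d hB hu0 hgen hcov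
  refine ⟨D₀, fun D _ hD hq χ hquad hprim => ?_⟩
  have hne : χ ≠ 1 := by
    rintro rfl
    rw [DirichletCharacter.isPrimitive_def, DirichletCharacter.conductor_one] at hprim
    omega
  have hL0 : 0 < Real.log D := by
    have h1 : (1 : ℝ) < (D : ℝ) := by exact_mod_cast lt_of_lt_of_le (by norm_num) hq
    exact Real.log_pos h1
  refine Hecke.lOne_ge_of_noRealZero_near_one χ hq hne hquad.sq_eq_one fun σ h1 h2 => ?_
  rcases lt_or_eq_of_le h2 with h2 | rfl
  · refine hD₀ D hD χ hquad hprim σ ?_ h2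
    -- `1 − (u₀/B)/log D < 1 − 1/(4 log D) ≤ σ` since `u₀/B > 1/4`
    have hquarter : 1 / 4 < d.u₀ / B := by
      rw [lt_div_iff₀ hB]; linarith
    have : 1 / (4 * Real.log D) < d.u₀ / B / Real.log D := by
      rw [show 1 / (4 * Real.log D) = (1 / 4) / Real.log D by ring]
      exact div_lt_div_of_pos_right hquarter hL0
    linarith
  · rw [Complex.ofReal_one]
    exact χ.LFunction_apply_one_ne_zero hne

/-! ### The dictionary is evidence-free: the gate's junk inhabitant (ls-ref-1 g2 02:36:14Z) -/

open scoped Classical in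
/-- **The junk inhabitant** of `Design` (ls-ref-1's model-consistency gate): every modulus served at
every scale (`window := univ`), `θ := 1`, and `dev X D := 𝟙[RealZeroWithin u₀ X D]` — for which
`forced` holds by construction. It carries no arithmetic content; it exists to show that a
`Design` instance by itself is NOT progress. [cite: MontgomeryVaughan2007, §11.2 (exceptional
zero; the indicator of its presence)] -/
def junkDesign (u₀ : ℝ) : Design where
  window := fun _ => Set.univ
  dev := fun X D => if ∃ h : NeZero D, @RealZeroWithin u₀ X D h then 1 else 0
  u₀ := u₀
  θ := 1
  hθ := one_pos
  forced := fun X D _ _ hz => by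
    have h : ∃ h : NeZero D, @RealZeroWithin u₀ X D h := ⟨inferInstance, hz⟩
    simp only [h, if_true, abs_one, le_refl]

open scoped Classical in
/-- For the junk inhabitant, the K-crux `GenericAsymptotics` IS LITERALLY an eventual
no-exceptional-zero statement: «for all large `X`, no modulus `D ≥ 1` has a real primitive
quadratic character with a real zero in `(1 − u₀/log X, 1)`». So `GenericAsymptotics d` for an
unpriced `d` can be anything up to `NoSiegelZeros` itself — the dictionary sentence of the file
docstring, in kernel. [cite: MontgomeryVaughan2007, §11.2 (exceptional zero)] -/
theorem genericAsymptotics_junkDesign_iff (u₀ : ℝ) :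
    GenericAsymptotics (junkDesign u₀) ↔
      ∃ X₀ : ℕ, ∀ X : ℕ, X₀ ≤ X → ∀ (D : ℕ) [NeZero D], ¬ RealZeroWithin u₀ X D := by
  constructor
  · intro h
    obtain ⟨X₀, hX₀⟩ := h 1 one_pos
    refine ⟨X₀, fun X hX D _ hz => ?_⟩
    have hlt := hX₀ X hX D (Set.mem_univ D)
    have hex : ∃ h : NeZero D, @RealZeroWithin u₀ X D h := ⟨inferInstance, hz⟩
    simp only [junkDesign, hex, if_true, abs_one, lt_self_iff_false] at hlt
  · rintro ⟨X₀, hX₀⟩ ε hε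
    refine ⟨X₀, fun X hX D _ _ => ?_⟩
    have hne : ¬ ∃ h : NeZero D, @RealZeroWithin u₀ X D h := by
      rintro ⟨h, hz⟩
      exact hX₀ X hX D hz
    simp only [junkDesign, hne, if_false, abs_zero]
    exact hε

/-- `junkDesign` serves every modulus at every scale, so it `Covers` with any `B > 0`… provided
scales with `0 < log X ≤ B log D` exist: for `B ≥ 1` take `X = D` (`D ≥ 2`).
[cite: MontgomeryVaughan2007, §11.2] -/
theorem covers_junkDesign (u₀ : ℝ) {B : ℝ} (hB : 1 ≤ B) : Covers (junkDesign u₀) B := by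
  intro X₀
  refine ⟨max X₀ 2, fun D hD => ⟨D, le_trans (le_max_left _ _) hD, Set.mem_univ D, ?_, ?_⟩⟩
  · have h2 : (2 : ℕ) ≤ D := le_trans (le_max_right _ _) hD
    have : (1 : ℝ) < D := by exact_mod_cast lt_of_lt_of_le (by norm_num) h2
    exact Real.log_pos this
  · have h2 : (2 : ℕ) ≤ D := le_trans (le_max_right _ _) hD
    have hlog : 0 ≤ Real.log D := Real.log_nonneg (by exact_mod_cast le_trans (by norm_num) h2)
    nlinarith

end Literature.NumberTheory.LFunctions.TwoWorld

end
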